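import Literature.Analysis.Distribution.FourierLaplaceHolomorphic
import HarnessLib

/-!
# Global growth of the Fourier–Laplace transform of a distribution with spectrum in a cone

Topic `Literature/Analysis/Distribution`. For a continuous linear functional `T` on `𝓢(ℝ^ι, ℂ)`
whose inverse Fourier transform `u = 𝓕⁻¹T` is supported in a cone `S` (support hypothesis
`Disjoint (tsupport (𝓕φ)) S → T φ = 0`, as in `fourierLaplace_coneSupport`), the concrete
Fourier–Laplace transform `F = fourierLaplaceFun T S` of `FourierLaplaceTransform` satisfies the
**global tube estimate**

  `‖F(z)‖ ≤ c (1 + ‖z‖)^N (1 + ρ⁻¹)^r`  whenever `closedBall (Im z) ρ ⊆ S⁻`, `ρ > 0`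

(`exists_norm_fourierLaplaceFun_le_of_closedBall_subset`), with `c, N, r` depending on `T, S`
only — uniform over all directions of the open cone `interior S⁻` and all sizes of `Im z`. The
tree's `fourierLaplace_coneSupport_edgeGrowth_holds` (`FourierLaplaceEdgeGrowth`; Streater–Wightman
Thm. 2-10, (2-80)) and `exists_norm_fourierLaplaceFun_le` (`FourierLaplaceHolomorphic`; Hörmander
Thm. 7.4.2) give such bounds only for `Im z` in `t·K`, `K` a compact subset of the cone, which is
not enough at the Euclidean points of quantum field theory (whose imaginary parts `(x_k⁰ e₀)_k`
have directions approaching the boundary of the tube cone); the present file supplies the form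
used by `Literature/MathematicalPhysics/QuantumFieldTheory/WightmanToSchwingerProofs`.

## The printed estimates and the proof

Hörmander (1990), Thm. 7.4.3, (7.4.6) (held 2003 printing, pdf p. 162): for `K = S` a closed
convex cone the supporting function `H_S` vanishes on `S⁻`, so `|û(ζ)| ≤ C(1 + |ζ|)^N` uniformly
on every translated cone `Im ζ ∈ η + S⁻`, `η` in a compact subset of the open cone; the same is
Streater–Wightman (1964), Thm. 2-8, (2-78) (pdf p. 55 of the held 2000 printing). The power law at
the edge is Streater–Wightman Thm. 2-10, (2-80) (pdf p. 56), `|ℒ(T)(ξ − itη)| ≤ P_K(ξ) t^{-r}`,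
`η ∈ K` compact, `0 < t < 1`, and Vladimirov (1966), §26.4, (18) (held Dover reprint, pdf p. 199),
`|f(z)| ≤ M(C′)(1 + |z|)^β (1 + |y|^{-α})` on compact subcones `C′`. The radius form proved here
(constants independent of the direction) is obtained directly from the construction of `F`:

* `fourierLaplaceFun_eq_fourierInvDual_scaledKernel` (*cutoff independence*): `F(z) = u(χ e_z)`
  does not change if the fixed cutoff `χ_S` (`= 1` on `thickening 1 S`) is replaced by the
  **rescaled cutoff** `χ_S(L ·)`, `L = 1 + ‖Im z‖` (`scaledCutoff`, `scaledKernel`), because the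
  two kernels agree on the neighbourhood `thickening (1/L) S` of `S ⊇ supp u`;
* `re_expForm_le_of_mem_tsupport_scaledCutoff`: on the support of the rescaled cutoff
  `2π⟪Im z, ξ⟫ ≤ 6π − 2πρ‖ξ‖` — the transition region now costs `e^{6π}` instead of
  `e^{6π‖Im z‖}` — while the derivatives of the rescaled cutoff cost `Lⁿ`
  (`norm_iteratedFDeriv_scaledCutoff_le`);
* `pow_mul_exp_neg_mul_le`, `seminorm_le_of_exp_bound'`: `sᵏe^{−cs} ≤ (k/c)ᵏ`, so the Schwartz
  seminorms of the rescaled kernel are `≤ D (1 + ‖z‖)^{2n} ρ^{-k}` (`seminorm_scaledKernel_le`);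
* `u` is bounded by finitely many seminorms (`exists_bound_seminorm_clm`).

## References

* L. Hörmander, *The Analysis of Linear Partial Differential Operators I*, 2nd ed. (1990; held
  2003 printing), Thm. 7.4.2 and Thm. 7.4.3, eq. (7.4.6) (pdf pp. 160–162). [HormanderALPDO1]
* R. F. Streater, A. S. Wightman, *PCT, Spin and Statistics, and All That* (1964; held 2000
  printing), §2-3, Thm. 2-8, eq. (2-78) (pdf p. 55), Thm. 2-10, eq. (2-80) (pdf p. 56).
  [StreaterWightman1964]
* V. S. Vladimirov, *Methods of the Theory of Functions of Many Complex Variables* (1966; held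
  Dover reprint), §26.4, eq. (18) and Thm. 2 (pdf pp. 199–200). [Vladimirov1966]

## Mathlib / tree

Used: `ContinuousLinearMap.iteratedFDeriv_comp_right`,
`ContinuousMultilinearMap.norm_compContinuousLinearMap_le`, `SchwartzMap.seminorm_le_bound`,
`Seminorm.finset_sup_apply_le`, `Metric.mem_thickening_iff`, `dist_smul₀`; from the tree
`FourierLaplaceTransform` (`laplaceKernel`, `coneCutoff`, `expForm`, `fourierInvDual_eq_zero`),
`FourierLaplaceHolomorphic` (`exists_bound_seminorm_clm`), `ConeCutoffEstimates`
(`norm_iteratedFDeriv_cutoff_cexp_le`, `inner_le_of_mem_thickening`), `ExpLinearEstimates`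
(`schwartz_decay_of_exp_bound`). Nothing here is specific to quantum field theory.
-/

noncomputable section

open Set Filter Metric SchwartzMap
open _root_.Complex (exp I)
open scoped ContDiff Topology RealInnerProductSpace SchwartzMap FourierTransform

namespace Literature.Analysis.Distribution

variable {ι : Type*} [Fintype ι]

/-! ### The rate lemma `sᵏe^{-cs} ≤ (k/c)ᵏ` -/

/-- `sᵏ e^{-cs} ≤ (k/c)ᵏ` for `s ≥ 0`, `c > 0` (maximum of `sᵏe^{-cs}` at `s = k/c`; here from
`u ≤ eᵘ` at `u = cs/k`). [folklore] -/
theorem pow_mul_exp_neg_mul_le (k : ℕ) {c s : ℝ} (hc : 0 < c) (hs : 0 ≤ s) :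
    s ^ k * Real.exp (-(c * s)) ≤ ((k : ℝ) / c) ^ k := by
  rcases Nat.eq_zero_or_pos k with rfl | hk
  · have : Real.exp (-(c * s)) ≤ 1 := Real.exp_le_one_iff.2 (by nlinarith)
    simpa using this
  · have hk' : (0 : ℝ) < k := by exact_mod_cast hk
    set u : ℝ := c * s / k with hu
    have hu0 : 0 ≤ u := by positivity
    have hsu : s = (k : ℝ) / c * u := by rw [hu]; field_simp
    have hcs : c * s = (k : ℝ) * u := by rw [hu]; field_simp
    have h1 : u ^ k ≤ Real.exp u ^ k :=
      pow_le_pow_left₀ hu0 (by linarith [Real.add_one_le_exp u]) k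
    rw [← Real.exp_nat_mul] at h1
    have hsk : s ^ k = ((k : ℝ) / c) ^ k * u ^ k := by rw [hsu, mul_pow]
    rw [hsk, hcs]
    calc ((k : ℝ) / c) ^ k * u ^ k * Real.exp (-((k : ℝ) * u))
        ≤ ((k : ℝ) / c) ^ k * Real.exp ((k : ℝ) * u) * Real.exp (-((k : ℝ) * u)) := by
          gcongr
      _ = ((k : ℝ) / c) ^ k := by
          rw [mul_assoc, ← Real.exp_add, add_neg_cancel, Real.exp_zero, mul_one]

/-- **Seminorm bound from a pure exponential bound, with the sharp power of the rate**: if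
`‖Dⁿf(x)‖ ≤ C e^{-c‖x‖}` for all `x` then `‖f‖_{k,n} ≤ C (k/c)ᵏ` (no `eᶜ` loss, in contrast to
`seminorm_le_of_exp_bound`; needed when the rate `c` is large). [folklore] -/
theorem seminorm_le_of_exp_bound' (f : 𝓢(EuclideanSpace ℝ ι, ℂ)) {c C : ℝ} (hc : 0 < c)
    (hC : 0 ≤ C) {n : ℕ} (h : ∀ x, ‖iteratedFDeriv ℝ n f x‖ ≤ C * Real.exp (-(c * ‖x‖))) (k : ℕ) :
    SchwartzMap.seminorm ℂ k n f ≤ C * ((k : ℝ) / c) ^ k := by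
  refine SchwartzMap.seminorm_le_bound ℂ k n f (by positivity) fun x => ?_
  calc ‖x‖ ^ k * ‖iteratedFDeriv ℝ n f x‖ ≤ ‖x‖ ^ k * (C * Real.exp (-(c * ‖x‖))) := by
        gcongr; exact h x
    _ = C * (‖x‖ ^ k * Real.exp (-(c * ‖x‖))) := by ring
    _ ≤ C * ((k : ℝ) / c) ^ k :=
        mul_le_mul_of_nonneg_left (pow_mul_exp_neg_mul_le k hc (norm_nonneg x)) hC

/-! ### The rescaled cutoff -/

/-- The scale `L(z) = 1 + ‖Im z‖` at which the cutoff is rescaled. [folklore] -/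
def kernelScale (z : ι → ℂ) : ℝ := 1 + ‖imVec z‖

/-- `1 ≤ L(z)`. [folklore] -/
theorem one_le_kernelScale (z : ι → ℂ) : 1 ≤ kernelScale z := by
  unfold kernelScale; linarith [norm_nonneg (imVec z)]

/-- `0 < L(z)`. [folklore] -/
theorem kernelScale_pos (z : ι → ℂ) : 0 < kernelScale z :=
  zero_lt_one.trans_le (one_le_kernelScale z)

/-- The **rescaled cutoff** `χ_S(L(z) ξ)`: equal to `1` on the thinner neighbourhood
`thickening (1/L) S` and supported in `thickening (3/L) S`, so that on its support the exponent
`2π⟪Im z, ξ⟫` exceeds its value on `S` by `O(1)` only (instead of `O(‖Im z‖)`). [folklore] -/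
def scaledCutoff (S : Set (EuclideanSpace ℝ ι)) (z : ι → ℂ) : EuclideanSpace ℝ ι → ℝ :=
  fun ξ => coneCutoff S (kernelScale z • ξ)

/-- The rescaled cutoff is smooth. [folklore] -/
theorem contDiff_scaledCutoff (S : Set (EuclideanSpace ℝ ι)) (z : ι → ℂ) :
    ContDiff ℝ ∞ (scaledCutoff S z) :=
  (contDiff_coneCutoff S).comp (contDiff_const_smul _)

/-- Derivative bounds of the rescaled cutoff: `‖Dⁱ(χ_S(L·))(ξ)‖ ≤ Lⁿ Cₙ` for `i ≤ n`
(chain rule along the linear map `ξ ↦ Lξ`, `L ≥ 1`). [folklore] -/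
theorem norm_iteratedFDeriv_scaledCutoff_le (S : Set (EuclideanSpace ℝ ι)) (z : ι → ℂ) {n i : ℕ}
    (hi : i ≤ n) (ξ : EuclideanSpace ℝ ι) :
    ‖iteratedFDeriv ℝ i (scaledCutoff S z) ξ‖ ≤ kernelScale z ^ n * coneCutoffBound S n := by
  set g : EuclideanSpace ℝ ι →L[ℝ] EuclideanSpace ℝ ι :=
    kernelScale z • ContinuousLinearMap.id ℝ (EuclideanSpace ℝ ι) with hg
  have hfun : scaledCutoff S z = coneCutoff S ∘ g := by
    funext ξ; simp [scaledCutoff, hg]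
  have hL1 := one_le_kernelScale z
  have hgn : ‖g‖ ≤ kernelScale z := by
    rw [hg, norm_smul, Real.norm_of_nonneg (kernelScale_pos z).le]
    exact mul_le_of_le_one_right (kernelScale_pos z).le ContinuousLinearMap.norm_id_le
  rw [hfun, g.iteratedFDeriv_comp_right (contDiff_coneCutoff S) ξ (i := i)
    (by exact_mod_cast le_top)]
  calc ‖(iteratedFDeriv ℝ i (coneCutoff S) (g ξ)).compContinuousLinearMap fun _ => g‖
      ≤ ‖iteratedFDeriv ℝ i (coneCutoff S) (g ξ)‖ * ∏ _j : Fin i, ‖g‖ :=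
        ContinuousMultilinearMap.norm_compContinuousLinearMap_le _ _
    _ ≤ coneCutoffBound S n * kernelScale z ^ i := by
        rw [Finset.prod_const, Finset.card_univ, Fintype.card_fin]
        exact mul_le_mul (norm_iteratedFDeriv_coneCutoff_le S hi _)
          (pow_le_pow_left₀ (norm_nonneg _) hgn i) (by positivity) (coneCutoffBound_nonneg S n)
    _ ≤ coneCutoffBound S n * kernelScale z ^ n :=
        mul_le_mul_of_nonneg_left (pow_le_pow_right₀ hL1 hi) (coneCutoffBound_nonneg S n)
    _ = kernelScale z ^ n * coneCutoffBound S n := mul_comm _ _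

/-- On the support of the rescaled cutoff, `L(z) ξ` lies in the support of `χ_S`, hence in
`thickening 3 S`. [folklore] -/
theorem smul_mem_of_mem_tsupport_scaledCutoff {S : Set (EuclideanSpace ℝ ι)} {z : ι → ℂ}
    {ξ : EuclideanSpace ℝ ι} (hξ : ξ ∈ tsupport (scaledCutoff S z)) :
    kernelScale z • ξ ∈ thickening 3 S := by
  have hcont : Continuous fun ξ : EuclideanSpace ℝ ι => kernelScale z • ξ := continuous_const_smul _
  have h1 : tsupport (scaledCutoff S z) ⊆
      (fun ξ : EuclideanSpace ℝ ι => kernelScale z • ξ) ⁻¹' tsupport (coneCutoff S) := by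
    refine closure_minimal ?_ ((isClosed_tsupport _).preimage hcont)
    intro x hx
    exact subset_closure (by simpa [scaledCutoff] using hx)
  exact tsupport_coneCutoff_subset S (h1 hξ)

/-- For a cone `S` the rescaled cutoff is `1` on `thickening (1/L) S` (`L ≥ 1`). [folklore] -/
theorem scaledCutoff_eq_one {S : Set (EuclideanSpace ℝ ι)}
    (hS : ∀ c : ℝ, 0 ≤ c → ∀ ξ ∈ S, c • ξ ∈ S) {z : ι → ℂ} {ξ : EuclideanSpace ℝ ι}
    (hξ : ξ ∈ thickening (kernelScale z)⁻¹ S) : scaledCutoff S z ξ = 1 := by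
  have hL := kernelScale_pos z
  obtain ⟨s, hs, hd⟩ := mem_thickening_iff.1 hξ
  refine coneCutoff_eq_one (mem_thickening_iff.2 ⟨kernelScale z • s, hS _ hL.le s hs, ?_⟩)
  rw [dist_smul₀, Real.norm_of_nonneg hL.le]
  calc kernelScale z * dist ξ s < kernelScale z * (kernelScale z)⁻¹ :=
        mul_lt_mul_of_pos_left hd hL
    _ = 1 := mul_inv_cancel₀ hL.ne'

/-! ### The exponent on the support of the rescaled cutoff -/

/-- If the closed ball of radius `ρ` about `y` lies in the polar cone `S⁻`, then
`⟪y, s⟫ ≤ −ρ‖s‖` on `S` (the point `y + ρ s/‖s‖` is in `S⁻`). [folklore] -/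
theorem inner_le_neg_mul_norm_of_closedBall_subset {S : Set (EuclideanSpace ℝ ι)}
    {y : EuclideanSpace ℝ ι} {ρ : ℝ} (hρ : 0 ≤ ρ) (hball : closedBall y ρ ⊆ polarCone S)
    {s : EuclideanSpace ℝ ι} (hs : s ∈ S) : ⟪y, s⟫ ≤ -(ρ * ‖s‖) := by
  rcases eq_or_ne s 0 with rfl | hs0
  · simp
  have hnorm : 0 < ‖s‖ := norm_pos_iff.2 hs0
  set y' : EuclideanSpace ℝ ι := y + (ρ / ‖s‖) • s with hy'
  have hy'mem : y' ∈ polarCone S := by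
    refine hball (mem_closedBall.2 (le_of_eq ?_))
    rw [hy', dist_eq_norm, add_sub_cancel_left, norm_smul, norm_div, Real.norm_of_nonneg hρ,
      norm_norm, div_mul_cancel₀ ρ hnorm.ne']
  have h := (mem_polarCone_iff.1 hy'mem) s hs
  rw [hy', inner_add_left, real_inner_smul_left, real_inner_self_eq_norm_sq] at h
  have e : ρ / ‖s‖ * ‖s‖ ^ 2 = ρ * ‖s‖ := by field_simp
  linarith

/-- **The exponent on the support of the rescaled cutoff exceeds its values on the cone by `O(1)`
only**: if `closedBall (Im z) ρ ⊆ S⁻` with `0 < ρ ≤ 1` then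
`Re(−2πi⟨z, ξ⟩) = 2π⟪Im z, ξ⟫ ≤ 6π − 2πρ‖ξ‖` for all `ξ ∈ tsupport χ_S(L(z)·)`. [folklore] -/
theorem re_expForm_le_of_mem_tsupport_scaledCutoff {S : Set (EuclideanSpace ℝ ι)} {z : ι → ℂ}
    {ρ : ℝ} (hρ : 0 < ρ) (hρ1 : ρ ≤ 1) (hball : closedBall (imVec z) ρ ⊆ polarCone S)
    {ξ : EuclideanSpace ℝ ι} (hξ : ξ ∈ tsupport (scaledCutoff S z)) :
    (expForm z ξ).re ≤ 6 * Real.pi - 2 * Real.pi * ρ * ‖ξ‖ := by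
  set L := kernelScale z with hLdef
  have hL : 0 < L := kernelScale_pos z
  have hyS : ∀ s ∈ S, ⟪imVec z, s⟫ ≤ -(ρ * ‖s‖) := fun s hs =>
    inner_le_neg_mul_norm_of_closedBall_subset hρ.le hball hs
  have h1 := inner_le_of_mem_thickening hρ.le hyS (smul_mem_of_mem_tsupport_scaledCutoff hξ)
  rw [real_inner_smul_right, norm_smul, Real.norm_of_nonneg hL.le] at h1
  -- `L ⟪y, ξ⟫ ≤ -ρ L ‖ξ‖ + 3 (ρ + ‖y‖) ≤ -ρ L ‖ξ‖ + 3 L`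
  have h2 : ρ + ‖imVec z‖ ≤ L := by rw [hLdef, kernelScale]; linarith
  have h3 : L * ⟪imVec z, ξ⟫ ≤ L * (-(ρ * ‖ξ‖) + 3) := by nlinarith
  have h4 : ⟪imVec z, ξ⟫ ≤ -(ρ * ‖ξ‖) + 3 := le_of_mul_le_mul_left h3 hL
  rw [re_expForm_apply]
  nlinarith [Real.pi_pos]

/-! ### The rescaled kernel -/

/-- The kernel function with the rescaled cutoff, `ξ ↦ χ_S(L(z)ξ) e^{−2πi⟨z, ξ⟩}`. [folklore] -/
def scaledKernelFun (S : Set (EuclideanSpace ℝ ι)) (z : ι → ℂ) : EuclideanSpace ℝ ι → ℂ :=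
  fun ξ => (scaledCutoff S z ξ : ℂ) * exp (expForm z ξ)

/-- The rescaled kernel is smooth. [folklore] -/
theorem contDiff_scaledKernelFun (S : Set (EuclideanSpace ℝ ι)) (z : ι → ℂ) :
    ContDiff ℝ ∞ (scaledKernelFun S z) :=
  contDiff_cutoff_cexp (contDiff_scaledCutoff S z) (expForm z)

/-- **The basic estimate for the rescaled kernel**: if `closedBall (Im z) ρ ⊆ S⁻`, `0 < ρ ≤ 1`,
then `‖Dⁿ(scaledKernelFun S z)(ξ)‖ ≤ 2ⁿ L^{n'} C_{n'} (1 + ‖expForm z‖)ⁿ e^{6π} e^{−2πρ‖ξ‖}` for any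
`n' ≥ n` (the cutoff bounds are used up to order `n'`). [folklore] -/
theorem norm_iteratedFDeriv_scaledKernelFun_le {S : Set (EuclideanSpace ℝ ι)} {z : ι → ℂ}
    {ρ : ℝ} (hρ : 0 < ρ) (hρ1 : ρ ≤ 1) (hball : closedBall (imVec z) ρ ⊆ polarCone S) {n n' : ℕ}
    (hn : n ≤ n') (ξ : EuclideanSpace ℝ ι) :
    ‖iteratedFDeriv ℝ n (scaledKernelFun S z) ξ‖ ≤
      2 ^ n * (kernelScale z ^ n' * coneCutoffBound S n') * (1 + ‖expForm z‖) ^ n *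
        Real.exp (6 * Real.pi) * Real.exp (-(2 * Real.pi * ρ * ‖ξ‖)) :=
  norm_iteratedFDeriv_cutoff_cexp_le (contDiff_scaledCutoff S z)
    (fun _ hi x => norm_iteratedFDeriv_scaledCutoff_le S z (hi.trans hn) x) (expForm z)
    (fun _ hx => re_expForm_le_of_mem_tsupport_scaledCutoff hρ hρ1 hball hx) ξ

/-- A point of the open cone has a closed ball of radius `≤ 1` about it inside `S⁻`. [folklore] -/
theorem exists_closedBall_subset_of_mem_interior {S : Set (EuclideanSpace ℝ ι)}
    {y : EuclideanSpace ℝ ι} (hy : y ∈ interior (polarCone S)) :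
    ∃ ρ : ℝ, 0 < ρ ∧ ρ ≤ 1 ∧ closedBall y ρ ⊆ polarCone S := by
  obtain ⟨ε, hε, hsub⟩ := Metric.mem_nhds_iff.1 (mem_interior_iff_mem_nhds.1 hy)
  refine ⟨min (ε / 2) 1, by positivity, min_le_right _ _, ?_⟩
  exact (closedBall_subset_closedBall (min_le_left _ _)).trans
    ((closedBall_subset_ball (by linarith)).trans hsub)

/-- The rescaled kernel has Schwartz decay when `Im z` is in the open cone. [folklore] -/
theorem scaledKernelFun_decay (S : Set (EuclideanSpace ℝ ι)) {z : ι → ℂ}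
    (hz : imVec z ∈ interior (polarCone S)) (k n : ℕ) :
    ∃ C : ℝ, ∀ ξ, ‖ξ‖ ^ k * ‖iteratedFDeriv ℝ n (scaledKernelFun S z) ξ‖ ≤ C := by
  obtain ⟨ρ, hρ, hρ1, hball⟩ := exists_closedBall_subset_of_mem_interior hz
  refine schwartz_decay_of_exp_bound (c := 2 * Real.pi * ρ) (by positivity) (fun m =>
    ⟨2 ^ m * (kernelScale z ^ m * coneCutoffBound S m) * (1 + ‖expForm z‖) ^ m *
      Real.exp (6 * Real.pi), 0, fun ξ => ?_⟩) k n
  simpa using norm_iteratedFDeriv_scaledKernelFun_le hρ hρ1 hball le_rfl ξ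

open Classical in
/-- **The rescaled kernel as a Schwartz function** (`0` off the tube). [folklore] -/
def scaledKernel (S : Set (EuclideanSpace ℝ ι)) (z : ι → ℂ) : 𝓢(EuclideanSpace ℝ ι, ℂ) :=
  if hz : imVec z ∈ interior (polarCone S) then
    ⟨scaledKernelFun S z, contDiff_scaledKernelFun S z, scaledKernelFun_decay S hz⟩
  else 0

/-- On the tube the Schwartz rescaled kernel is the rescaled kernel function. [folklore] -/
theorem coe_scaledKernel {S : Set (EuclideanSpace ℝ ι)} {z : ι → ℂ}
    (hz : imVec z ∈ interior (polarCone S)) : ⇑(scaledKernel S z) = scaledKernelFun S z := by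
  rw [scaledKernel, dif_pos hz]
  rfl

/-- **Seminorms of the rescaled kernel**: if `closedBall (Im z) ρ ⊆ S⁻`, `0 < ρ ≤ 1`, then
`‖scaledKernel S z‖_{k,n} ≤ 2ⁿ Lⁿ Cₙ (1 + ‖expForm z‖)ⁿ e^{6π} (k / (2πρ))ᵏ`. [folklore] -/
theorem seminorm_scaledKernel_le {S : Set (EuclideanSpace ℝ ι)} {z : ι → ℂ}
    {ρ : ℝ} (hρ : 0 < ρ) (hρ1 : ρ ≤ 1) (hball : closedBall (imVec z) ρ ⊆ polarCone S) (k : ℕ)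
    {n n' : ℕ} (hn : n ≤ n') :
    SchwartzMap.seminorm ℂ k n (scaledKernel S z) ≤
      2 ^ n * (kernelScale z ^ n' * coneCutoffBound S n') * (1 + ‖expForm z‖) ^ n *
        Real.exp (6 * Real.pi) * ((k : ℝ) / (2 * Real.pi * ρ)) ^ k := by
  have hz : imVec z ∈ interior (polarCone S) :=
    interior_maximal (ball_subset_closedBall.trans hball) isOpen_ball (mem_ball_self hρ)
  have hC0 : 0 ≤ 2 ^ n * (kernelScale z ^ n' * coneCutoffBound S n') * (1 + ‖expForm z‖) ^ n *
      Real.exp (6 * Real.pi) := by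
    have := coneCutoffBound_nonneg S n'; have := kernelScale_pos z; positivity
  refine seminorm_le_of_exp_bound' (scaledKernel S z) (c := 2 * Real.pi * ρ) (by positivity) hC0
    (fun ξ => ?_) k
  rw [coe_scaledKernel hz]
  exact norm_iteratedFDeriv_scaledKernelFun_le hρ hρ1 hball hn ξ

/-! ### Cutoff independence and the global bound -/

/-- **Cutoff independence**: under the support hypothesis on `T` (the inverse Fourier transform
`u` of `T` is supported in the cone `S`), the Fourier–Laplace transform may be computed with the
rescaled cutoff, `F(z) = u(χ_S(L(z)·) e^{−2πi⟨z,·⟩})`, since the two kernels agree on the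
neighbourhood `thickening (1/L) S` of `S ⊇ supp u` (Hörmander (1990), Thm. 7.4.2: "`û_φ` is
independent of the choice of `φ`"). [cite: HormanderALPDO1, Thm 7.4.2] -/
theorem fourierLaplaceFun_eq_fourierInvDual_scaledKernel {T : 𝓢(EuclideanSpace ℝ ι, ℂ) →L[ℂ] ℂ}
    {S : Set (EuclideanSpace ℝ ι)}
    (hT : ∀ φ : 𝓢(EuclideanSpace ℝ ι, ℂ),
      Disjoint (tsupport (⇑(SchwartzMap.fourierTransformCLM ℂ φ))) S → T φ = 0)
    (hS : ∀ c : ℝ, 0 ≤ c → ∀ ξ ∈ S, c • ξ ∈ S) {z : ι → ℂ}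
    (hz : imVec z ∈ interior (polarCone S)) :
    fourierLaplaceFun T S z = fourierInvDual T (scaledKernel S z) := by
  set G := laplaceKernel S z - scaledKernel S z with hG
  have hG0 : ∀ ξ ∈ thickening (kernelScale z)⁻¹ S, G ξ = 0 := fun ξ hξ => by
    have hξ1 : ξ ∈ thickening 1 S :=
      thickening_mono (inv_le_one_of_one_le₀ (one_le_kernelScale z)) S hξ
    have h1 : G ξ = laplaceKernel S z ξ - scaledKernel S z ξ := rfl
    rw [h1, laplaceKernel_apply hz, coe_scaledKernel hz]
    simp only [scaledKernelFun, coneCutoff_eq_one hξ1, scaledCutoff_eq_one hS hξ, sub_self]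
  have hsupp : tsupport (⇑G) ⊆ (thickening (kernelScale z)⁻¹ S)ᶜ := by
    refine closure_minimal (fun ξ hξ => ?_) isOpen_thickening.isClosed_compl
    exact fun h => hξ (hG0 ξ h)
  have hdisj : Disjoint (tsupport (⇑G)) S :=
    Set.disjoint_of_subset_left hsupp
      (disjoint_compl_left.mono_right (self_subset_thickening (inv_pos.2 (kernelScale_pos z)) S))
  have h0 : fourierInvDual T G = 0 := fourierInvDual_eq_zero hT hdisj
  have e : laplaceKernel S z = G + scaledKernel S z := by rw [hG, sub_add_cancel]
  rw [fourierLaplaceFun_apply, e, map_add, h0, zero_add]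

omit [Fintype ι] in
/-- `1 + (min ρ 1)⁻¹ ≤ 2 (1 + ρ⁻¹)` for `ρ > 0`. [folklore] -/
theorem one_add_inv_min_le {ρ : ℝ} (hρ : 0 < ρ) : 1 + (min ρ 1)⁻¹ ≤ 2 * (1 + ρ⁻¹) := by
  rcases le_total ρ 1 with h | h
  · rw [min_eq_left h]
    have : 0 < ρ⁻¹ := inv_pos.2 hρ
    linarith
  · rw [min_eq_right h, inv_one]
    have : 0 ≤ ρ⁻¹ := inv_nonneg.2 hρ.le
    linarith

/-- **Global growth of the Fourier–Laplace transform in the tube.** Let `u = 𝓕⁻¹T` be supported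
in the cone `S` (support hypothesis on `T` as in `fourierLaplace_coneSupport`). There are
`c, N, r` such that for every `z` and every `ρ > 0` with `closedBall (Im z) ρ ⊆ S⁻`,

  `‖F(z)‖ ≤ c (1 + ‖z‖)^N (1 + ρ⁻¹)^r`,  `F = fourierLaplaceFun T S`.

The printed estimates it unifies: Hörmander (1990), Thm. 7.4.3, (7.4.6) — for `K = S` a closed
convex cone `H_S = 0` on `S⁻`, so `|û(ζ)| ≤ C(1 + |ζ|)^N` uniformly on every translated cone
`Im ζ ∈ η + S⁻`, `η` in a compact subset of the open cone (likewise Streater–Wightman (1964),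
Thm. 2-8, (2-78)) — and the power law at the edge, Streater–Wightman Thm. 2-10, (2-80),
`|ℒ(T)(ξ − itη)| ≤ P_K(ξ) t^{-r}` for `η` in a compact `K`, `0 < t < 1` (Vladimirov (1966), §26.4,
(18): `|f(z)| ≤ M(C′)(1 + |z|)^β (1 + |y|^{-α})` on compact subcones `C′`). The present radius
form, with constants *independent of the direction of `Im z`*, is the one needed at Euclidean
points (whose directions are not confined to a compact subset of the cone) and is proved directly:
by cutoff independence compute `F(z)` with the cutoff rescaled at `L = 1 + ‖Im z‖`
(`fourierLaplaceFun_eq_fourierInvDual_scaledKernel`); on its support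
`2π⟪Im z, ξ⟫ ≤ 6π − 2πρ‖ξ‖` (`re_expForm_le_of_mem_tsupport_scaledCutoff`), its derivatives cost
`Lⁿ`, and `sup_s sᵏe^{−2πρ s} ≤ (k/2πρ)ᵏ`; `u` is bounded by finitely many seminorms.
[cite: HormanderALPDO1, Thm 7.4.3 eq. (7.4.6)] [cite: StreaterWightman1964, Thm 2-8 eq. (2-78) and Thm 2-10 eq. (2-80)] -/
theorem exists_norm_fourierLaplaceFun_le_of_closedBall_subset
    (T : 𝓢(EuclideanSpace ℝ ι, ℂ) →L[ℂ] ℂ) {S : Set (EuclideanSpace ℝ ι)}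
    (hT : ∀ φ : 𝓢(EuclideanSpace ℝ ι, ℂ),
      Disjoint (tsupport (⇑(SchwartzMap.fourierTransformCLM ℂ φ))) S → T φ = 0)
    (hS : ∀ c : ℝ, 0 ≤ c → ∀ ξ ∈ S, c • ξ ∈ S) :
    ∃ (c : ℝ) (N r : ℕ), 0 ≤ c ∧ ∀ (z : ι → ℂ) (ρ : ℝ), 0 < ρ →
      closedBall (imVec z) ρ ⊆ polarCone S →
        ‖fourierLaplaceFun T S z‖ ≤ c * (1 + ‖z‖) ^ N * (1 + ρ⁻¹) ^ r := by
  obtain ⟨k₀, n₀, Cu, hCu, hu⟩ := exists_bound_seminorm_clm (fourierInvDual T)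
  -- constants: `L ≤ κ₁ (1 + ‖z‖)`, `1 + ‖expForm z‖ ≤ κ₂ (1 + ‖z‖)`
  set κ₁ : ℝ := 1 + Real.sqrt (Fintype.card ι) with hκ₁
  set κ₂ : ℝ := 1 + 2 * Real.pi * Fintype.card ι with hκ₂
  have hκ₁1 : 1 ≤ κ₁ := by rw [hκ₁]; linarith [Real.sqrt_nonneg (Fintype.card ι : ℝ)]
  have hκ₂1 : 1 ≤ κ₂ := by
    rw [hκ₂]; have : (0 : ℝ) ≤ 2 * Real.pi * Fintype.card ι := by positivity
    linarith
  have hCn := coneCutoffBound_nonneg S n₀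
  set D : ℝ := 2 ^ n₀ * (κ₁ ^ n₀ * coneCutoffBound S n₀) * κ₂ ^ n₀ * Real.exp (6 * Real.pi) *
    (2 * (1 + k₀)) ^ k₀ with hD
  have hD0 : 0 ≤ D := by positivity
  refine ⟨Cu * D, n₀ + n₀, k₀, by positivity, fun z ρ hρ hball => ?_⟩
  -- reduce to `ρ ≤ 1`
  set ρ' : ℝ := min ρ 1 with hρ'
  have hρ'0 : 0 < ρ' := lt_min hρ one_pos
  have hρ'1 : ρ' ≤ 1 := min_le_right _ _
  have hball' : closedBall (imVec z) ρ' ⊆ polarCone S :=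
    (closedBall_subset_closedBall (min_le_left _ _)).trans hball
  have hz : imVec z ∈ interior (polarCone S) :=
    interior_maximal (ball_subset_closedBall.trans hball) isOpen_ball (mem_ball_self hρ)
  -- the quantities to be compared
  have hz1 : (1 : ℝ) ≤ 1 + ‖z‖ := by linarith [norm_nonneg z]
  have hL : kernelScale z ≤ κ₁ * (1 + ‖z‖) := by
    have h1 := norm_imVec_le z
    have h2 : 0 ≤ Real.sqrt (Fintype.card ι) := Real.sqrt_nonneg _
    unfold kernelScale
    nlinarith [norm_nonneg z, norm_nonneg (imVec z)]
  have hℓ : 1 + ‖expForm z‖ ≤ κ₂ * (1 + ‖z‖) := by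
    have := norm_expForm_le z
    nlinarith [norm_nonneg z, norm_nonneg (expForm z), Real.pi_pos]
  have hQ1 : (1 : ℝ) ≤ 2 * (1 + k₀) * (1 + ρ⁻¹) := by
    have : (0 : ℝ) ≤ k₀ := Nat.cast_nonneg _
    have : 0 ≤ ρ⁻¹ := inv_nonneg.2 hρ.le
    nlinarith
  -- every seminorm of index `≤ (k₀, n₀)` of the rescaled kernel is `≤ D (1+‖z‖)^{2n₀} (1+ρ⁻¹)^{k₀}`
  have hsem : ∀ m ∈ Finset.Iic (k₀, n₀), schwartzSeminormFamily ℂ (EuclideanSpace ℝ ι) ℂ m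
      (scaledKernel S z) ≤ D * (1 + ‖z‖) ^ (n₀ + n₀) * (1 + ρ⁻¹) ^ k₀ := by
    intro m hm
    have hm1 : m.1 ≤ k₀ := (Finset.mem_Iic.1 hm).1
    have hm2 : m.2 ≤ n₀ := (Finset.mem_Iic.1 hm).2
    rw [schwartzSeminormFamily_apply]
    refine (seminorm_scaledKernel_le hρ'0 hρ'1 hball' m.1 hm2).trans ?_
    -- compare factor by factor
    have f1 : (2 : ℝ) ^ m.2 ≤ 2 ^ n₀ := pow_le_pow_right₀ (by norm_num) hm2
    have f2 : kernelScale z ^ n₀ ≤ κ₁ ^ n₀ * (1 + ‖z‖) ^ n₀ := by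
      rw [← mul_pow]; exact pow_le_pow_left₀ (kernelScale_pos z).le hL n₀
    have f3 : (1 + ‖expForm z‖) ^ m.2 ≤ κ₂ ^ n₀ * (1 + ‖z‖) ^ n₀ := by
      calc (1 + ‖expForm z‖) ^ m.2 ≤ (κ₂ * (1 + ‖z‖)) ^ m.2 :=
            pow_le_pow_left₀ (by positivity) hℓ _
        _ ≤ (κ₂ * (1 + ‖z‖)) ^ n₀ :=
            pow_le_pow_right₀ (one_le_mul_of_one_le_of_one_le hκ₂1 hz1) hm2
        _ = κ₂ ^ n₀ * (1 + ‖z‖) ^ n₀ := mul_pow _ _ _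
    have f4 : ((m.1 : ℝ) / (2 * Real.pi * ρ')) ^ m.1 ≤ (2 * (1 + k₀)) ^ k₀ * (1 + ρ⁻¹) ^ k₀ := by
      have hq : (m.1 : ℝ) / (2 * Real.pi * ρ') ≤ 2 * (1 + k₀) * (1 + ρ⁻¹) := by
        have hm1' : (m.1 : ℝ) ≤ k₀ := by exact_mod_cast hm1
        have hk0 : (0 : ℝ) ≤ k₀ := Nat.cast_nonneg _
        have hi := one_add_inv_min_le hρ
        have hρi : 0 < ρ⁻¹ := inv_pos.2 hρ
        calc (m.1 : ℝ) / (2 * Real.pi * ρ') ≤ k₀ / (2 * Real.pi * ρ') := by gcongr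
          _ ≤ k₀ / ρ' :=
              div_le_div_of_nonneg_left hk0 hρ'0 (by nlinarith [Real.two_le_pi])
          _ = k₀ * ρ'⁻¹ := div_eq_mul_inv _ _
          _ ≤ k₀ * (2 * (1 + ρ⁻¹)) := by
              refine mul_le_mul_of_nonneg_left ?_ hk0
              rw [hρ']; linarith
          _ ≤ 2 * (1 + k₀) * (1 + ρ⁻¹) := by nlinarith
      calc ((m.1 : ℝ) / (2 * Real.pi * ρ')) ^ m.1 ≤ (2 * (1 + k₀) * (1 + ρ⁻¹)) ^ m.1 :=
            pow_le_pow_left₀ (by positivity) hq _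
        _ ≤ (2 * (1 + k₀) * (1 + ρ⁻¹)) ^ k₀ := pow_le_pow_right₀ hQ1 hm1
        _ = (2 * (1 + k₀)) ^ k₀ * (1 + ρ⁻¹) ^ k₀ := mul_pow _ _ _
    have hexp : 0 ≤ Real.exp (6 * Real.pi) := (Real.exp_pos _).le
    calc 2 ^ m.2 * (kernelScale z ^ n₀ * coneCutoffBound S n₀) * (1 + ‖expForm z‖) ^ m.2 *
          Real.exp (6 * Real.pi) * ((m.1 : ℝ) / (2 * Real.pi * ρ')) ^ m.1
        ≤ 2 ^ n₀ * (κ₁ ^ n₀ * (1 + ‖z‖) ^ n₀ * coneCutoffBound S n₀) *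
            (κ₂ ^ n₀ * (1 + ‖z‖) ^ n₀) * Real.exp (6 * Real.pi) *
            ((2 * (1 + k₀)) ^ k₀ * (1 + ρ⁻¹) ^ k₀) := by
          have := kernelScale_pos z
          gcongr
      _ = D * (1 + ‖z‖) ^ (n₀ + n₀) * (1 + ρ⁻¹) ^ k₀ := by rw [hD, pow_add]; ring
  -- conclusion
  rw [fourierLaplaceFun_eq_fourierInvDual_scaledKernel hT hS hz]
  refine (hu _).trans ?_
  have hsup : (Finset.Iic (k₀, n₀)).sup (schwartzSeminormFamily ℂ (EuclideanSpace ℝ ι) ℂ)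
      (scaledKernel S z) ≤ D * (1 + ‖z‖) ^ (n₀ + n₀) * (1 + ρ⁻¹) ^ k₀ :=
    Seminorm.finset_sup_apply_le (by positivity) hsem
  calc Cu * (Finset.Iic (k₀, n₀)).sup (schwartzSeminormFamily ℂ (EuclideanSpace ℝ ι) ℂ)
        (scaledKernel S z) ≤ Cu * (D * (1 + ‖z‖) ^ (n₀ + n₀) * (1 + ρ⁻¹) ^ k₀) :=
        mul_le_mul_of_nonneg_left hsup hCu
    _ = Cu * D * (1 + ‖z‖) ^ (n₀ + n₀) * (1 + ρ⁻¹) ^ k₀ := by ring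

end Literature.Analysis.Distribution
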